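import Literature.NumberTheory.EllipticCurves.PAdicLFunctionIntegralityAtTwoAutoProofs
import Summits.BirchSwinnertonDyer.Rank1Residual.X1.MuLambdaAlgebra
import Summits.BirchSwinnertonDyer.Rank2.RefFifteenFacts
import HarnessLib

/-!
# X₂(d) of T-r3₂, analytic part: symbol-parity LAW at level 15 ⟹ `L₂(f₁₅, α) = 2·(unit of Λ)`, `λ = 0`

Cell `bsd-rank2`, seat `bsd-rank2-eng-2` GEN 4 (D-0071), for p2 GEN 15's route `MatsunoAnalyticTwin` (reference
curve `refFifteen = [1,1,1,0,0]` = Cremona 15A8, `x₀ = −1`) and lit GEN 16's memo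
`HOME/lit/g16/X2d-lambda-level15.md` (F1–F3, ADDENDUM 2: the LAW verified exactly on generators of `Γ₀(15)`,
kit j272806 / j272821). THE DERIVATION «LAW ⟹ L₂ = 2·unit» lit asked eng for (≈ 200 lines), done here.

THE ARGUMENT (Mazur–Tate–Teitelbaum 1986 §I.10–§I.13 on the tree's objects `ratPlusSymbol`, `msdMeasure`,
`padicLRiemannSum`, `padicLCoeff`; `a₂ = −1`, `α` the unit root of `X² + X + 2`, `β = α⁻¹`):
* `α³ − α² = 4`, so `1 − β = 4β³` (`one_sub_inv_eq_four_mul`);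
* with `[0]⁺ = K/8`, `K` odd, and `[a/2^m]⁺ = [0]⁺ + k_m/2`, `k_m ≡ m (mod 2)` (the LAW at the cusps `a/2^m`,
  `a` odd): `μ(a + 2^{m+2}ℤ₂) = (β^{m+2}/2)·(Kβ³ + k_{m+2} − βk_{m+1})` and the bracket is
  `(K + k_{m+2} − k_{m+1}) + K(β³ − 1) + k_{m+1}(1 − β) ∈ 2ℤ₂` (even integer + multiples of `4β³`), so
  **`‖μ(a + 2^{m+2}ℤ₂)‖₂ ≤ 1` for odd `a`** (`norm_msdMeasure_two_le_one_of_parity`; INT2-AUTO had `≤ 2` for all `a`);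
* the `Δ = {±1}` doubling `padicLRiemannSum_two`: every Riemann sum is `2 × Σ_s μ(5ˢ + 2ⁿ⁺²ℤ₂)·C(s,k)` with `5ˢ`
  odd, so has norm `≤ ½`; the sums converge (`tendsto_padicLRiemannSum_of_norm_le`), hence **every coefficient
  of `L₂(f, α, T)` lies in `2ℤ₂`** (`norm_padicLCoeff_two_le_half_of_parity`);
* the constant term is `(1 − β)²[0]⁺ = 2Kβ⁶` (`padicLRiemannSum_zero`), of norm EXACTLY `½`;
* so `L₂(f, α, T) = 2·ι(u)` with `u ∈ Λ = ℤ₂⟦T⟧` a UNIT (`exists_isUnit_iwasawa_of_parity`), and EVERY nonzero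
  integral multiple `L₀` (`ι L₀ = c · L₂`, `c ∈ ℚ₂`) is `2^a · (unit)`: `λ(L₀) = 0` (`lam_eq_zero_of_isUnit_multiple`,
  the tree's `Rank1Residual.X1.MuLambda.lam`).
§3 specialises to `refFifteen = [1,1,1,0,0]` (`a₂ = −1` from `#Ẽ(𝔽₂) = 4`, ordinarity p510347) and any `f` with
`IsNewformOf refFifteen f`: `refFifteen_lam_eq_zero_of_parity`.

THE INPUT LEFT OPEN (displayed, not asserted): the level-15 symbol facts `[0]⁺_f = K/8` (`K` odd; in fact
`K = 1`: `L(f,1)/Ω⁺_f = 1/8`, Cremona Table 4) and the LAW `k(a/2^m) ≡ m (mod 2)` — a FINITE exact modular-symbol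
computation (lit ADDENDUM 2: PARI `msfromell`, LAW on the 10 polygon generators of `Γ₀(15)`, 0 failures on 803
cusps; `kind: computation` grade). THEOREMS ONLY (no definition, no named fact, no `sorry`).
PARTITION: none — r_an ≥ 2, summit axis S0; TWIN (D-0056): n/a. B1 honesty: 2-adic bookkeeping on the tree's
`L₂`; nothing reads `r_an`; no S0 motion.

References: B. Mazur, J. Tate, J. Teitelbaum, *Invent. Math.* 84 (1986) §I.10–§I.13 [MazurTateTeitelbaum1986Invent];
J. E. Cremona, *Algorithms for modular elliptic curves* (1997) §2.8, Table 1 (15A), Table 4 [CremonaAlgorithms1997];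
L. Washington, *Introduction to Cyclotomic Fields* §7.1 [Washington1997].
-/

noncomputable section

open Filter Topology

open scoped MatrixGroups

open CongruenceSubgroup Literature.NumberTheory.EllipticCurves
  Literature.NumberTheory.EllipticCurves.ModularForms Summit.BirchSwinnertonDyer.Rank1Residual.X1

namespace Summit.BirchSwinnertonDyer.Rank2.SymbolParityAtTwo

/-! ### §1 `2`-adic arithmetic of the unit root of `X² + X + 2` and of the measure -/

section Generic

variable {N : ℕ} [NeZero N] {f : CuspForm (Gamma0 N) 2}

/-- `‖2‖₂ = 1/2`. [folklore] -/
private theorem norm_two_two : ‖(2 : ℚ_[2])‖ = (2 : ℝ)⁻¹ := by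
  have h := Padic.norm_p (p := 2)
  simpa using h

/-- An even integer has `2`-adic norm `≤ 1/2`. [folklore] -/
private theorem norm_two_mul_intCast_le (z : ℤ) : ‖(2 : ℚ_[2]) * (z : ℚ_[2])‖ ≤ (2 : ℝ)⁻¹ := by
  rw [norm_mul, norm_two_two]
  calc (2 : ℝ)⁻¹ * ‖(z : ℚ_[2])‖ ≤ 2⁻¹ * 1 := by gcongr; exact Padic.norm_int_le_one z
    _ = 2⁻¹ := mul_one _

/-- An odd integer is a `2`-adic unit: `‖K‖₂ = 1`. [folklore] -/
private theorem norm_intCast_eq_one_of_odd {K : ℤ} (hK : Odd K) : ‖(K : ℚ_[2])‖ = 1 := by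
  refine le_antisymm (Padic.norm_int_le_one K) (not_lt.mp fun h ↦ ?_)
  have h2 : (2 : ℤ) ∣ K := by exact_mod_cast (Padic.norm_intCast_lt_one_iff (p := 2)).mp h
  exact (Int.not_even_iff_odd.mpr hK) (even_iff_two_dvd.mpr h2)

/-- **The unit root of `X² + X + 2`**: `α³ − α² = 4`, i.e. `1 − α⁻¹ = 4·α⁻³`. [folklore] -/
theorem one_sub_inv_eq_four_mul {α : ℚ_[2]} (hroot : α ^ 2 + α + 2 = 0) :
    1 - α⁻¹ = 4 * α⁻¹ ^ 3 := by
  have hα0 : α ≠ 0 := by rintro rfl; norm_num at hroot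
  field_simp
  linear_combination (α - 2) * hroot

omit [NeZero N] in
/-- **`‖μ_{f,α}(a + 2^{m+2}ℤ₂)‖₂ ≤ 1` for ODD `a`, from the symbol-parity LAW** (`[0]⁺ = K/8`, `K` odd;
`[a/2^m]⁺ = [0]⁺ + k/2` with `k ≡ m (mod 2)`; `α` the unit root of `X² + X + 2`):
`μ = (β^{m+2}/2)(Kβ³ + k_{m+2} − βk_{m+1})`, bracket `∈ 2ℤ₂`. [cite: MazurTateTeitelbaum1986Invent, §I.10 (10.1)] -/
theorem norm_msdMeasure_two_le_one_of_parity {α : ℚ_[2]} (hαu : ‖α‖ = 1) (hroot : α ^ 2 + α + 2 = 0)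
    (h0 : ∃ K : ℤ, Odd K ∧ ratPlusSymbol f 0 = (K : ℚ) / 8)
    (hlaw : ∀ m a : ℕ, Odd a →
      ∃ k : ℤ, ratPlusSymbol f ((a : ℚ) / (2 : ℚ) ^ m) = ratPlusSymbol f 0 + (k : ℚ) / 2 ∧
        (2 : ℤ) ∣ k - m)
    (m : ℕ) (a : ZMod (2 ^ (m + 2))) (ha : Odd a.val) : ‖msdMeasure f α (m + 2) a‖ ≤ 1 := by
  obtain ⟨K, hK, hK0⟩ := h0
  obtain ⟨k₁, hk₁, hd₁⟩ := hlaw (m + 1 + 1) a.val ha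
  obtain ⟨k₂, hk₂, hd₂⟩ := hlaw (m + 1) a.val ha
  have hα0 : α ≠ 0 := by rintro rfl; norm_num at hroot
  have hβ : ‖α⁻¹‖ ≤ 1 := by rw [norm_inv, hαu, inv_one]
  have h1β : 1 - α⁻¹ = 4 * α⁻¹ ^ 3 := one_sub_inv_eq_four_mul hroot
  -- the even integer `K + k₁ - k₂`
  obtain ⟨z, hz⟩ : ∃ z : ℤ, K + k₁ - k₂ = 2 * z := by
    obtain ⟨K', hK'⟩ := hK
    obtain ⟨d₁, hd₁⟩ := hd₁
    obtain ⟨d₂, hd₂⟩ := hd₂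
    refine ⟨K' + d₁ - d₂ + 1, ?_⟩
    push_cast at hd₁ hd₂
    linarith
  -- unfold the measure at level `m + 2 = (m + 1) + 1`
  simp only [msdMeasure]
  have hcast : ((2 : ℕ) : ℚ) = (2 : ℚ) := by norm_num
  rw [hcast, hk₁, hk₂, hK0]
  push_cast
  have hid : α⁻¹ ^ (m + 1 + 1) * ((K : ℚ_[2]) / 8 + (k₁ : ℚ_[2]) / 2) -
      α⁻¹ ^ (m + 1 + 2) * ((K : ℚ_[2]) / 8 + (k₂ : ℚ_[2]) / 2) =
      α⁻¹ ^ (m + 2) * 2⁻¹ *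
        ((2 : ℚ_[2]) * z + (K : ℚ_[2]) * (α⁻¹ ^ 3 - 1) + (k₂ : ℚ_[2]) * (1 - α⁻¹)) := by
    have hz' : (K : ℚ_[2]) + k₁ - k₂ = 2 * z := by exact_mod_cast hz
    linear_combination (α⁻¹ ^ (m + 2) * (K : ℚ_[2]) / 8) * h1β + (α⁻¹ ^ (m + 2) * 2⁻¹) * hz'
  rw [hid]
  -- the three terms of the bracket have norm `≤ 1/2`
  have h4 : ‖(4 : ℚ_[2]) * α⁻¹ ^ 3‖ ≤ 2⁻¹ := by
    have h44 : (4 : ℚ_[2]) = 2 * 2 := by norm_num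
    have hb3 : ‖α⁻¹‖ ^ 3 ≤ 1 := pow_le_one₀ (norm_nonneg _) hβ
    rw [h44, norm_mul, norm_mul, norm_two_two, norm_pow]
    calc (2 : ℝ)⁻¹ * 2⁻¹ * ‖α⁻¹‖ ^ 3 ≤ 2⁻¹ * 2⁻¹ * 1 := by gcongr
      _ ≤ 2⁻¹ := by norm_num
  have ht1 : ‖(2 : ℚ_[2]) * z‖ ≤ 2⁻¹ := norm_two_mul_intCast_le z
  have ht2 : ‖(K : ℚ_[2]) * (α⁻¹ ^ 3 - 1)‖ ≤ 2⁻¹ := by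
    have hfac : α⁻¹ ^ 3 - 1 = -((4 : ℚ_[2]) * α⁻¹ ^ 3) * (α⁻¹ ^ 2 + α⁻¹ + 1) := by
      rw [← h1β]; ring
    have hq : ‖α⁻¹ ^ 2 + α⁻¹ + 1‖ ≤ 1 := by
      refine (Padic.nonarchimedean _ _).trans (max_le ?_ (by rw [norm_one]))
      refine (Padic.nonarchimedean _ _).trans (max_le ?_ hβ)
      rw [norm_pow]; exact pow_le_one₀ (norm_nonneg _) hβ
    have hK1 : ‖(K : ℚ_[2])‖ ≤ 1 := Padic.norm_int_le_one K
    rw [hfac, norm_mul, norm_mul, norm_neg]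
    calc ‖(K : ℚ_[2])‖ * (‖(4 : ℚ_[2]) * α⁻¹ ^ 3‖ * ‖α⁻¹ ^ 2 + α⁻¹ + 1‖) ≤ 1 * (2⁻¹ * 1) := by
          gcongr
      _ = 2⁻¹ := by ring
  have ht3 : ‖(k₂ : ℚ_[2]) * (1 - α⁻¹)‖ ≤ 2⁻¹ := by
    have hk1 : ‖(k₂ : ℚ_[2])‖ ≤ 1 := Padic.norm_int_le_one k₂
    rw [h1β, norm_mul]
    calc ‖(k₂ : ℚ_[2])‖ * ‖(4 : ℚ_[2]) * α⁻¹ ^ 3‖ ≤ 1 * 2⁻¹ := by gcongr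
      _ = 2⁻¹ := one_mul _
  have hB : ‖(2 : ℚ_[2]) * z + (K : ℚ_[2]) * (α⁻¹ ^ 3 - 1) + (k₂ : ℚ_[2]) * (1 - α⁻¹)‖ ≤ 2⁻¹ :=
    (Padic.nonarchimedean _ _).trans (max_le ((Padic.nonarchimedean _ _).trans (max_le ht1 ht2)) ht3)
  rw [norm_mul, norm_mul, norm_inv, norm_two_two, inv_inv, norm_pow]
  calc ‖α⁻¹‖ ^ (m + 2) * 2 * _ ≤ 1 * 2 * 2⁻¹ := by
        gcongr
        exact pow_le_one₀ (norm_nonneg _) hβ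
    _ = 1 := by norm_num

/-- The classes `5ˢ mod 2ⁿ⁺²` met by the Riemann sums at `p = 2` are odd. [folklore] -/
theorem odd_val_cyclotomicGenerator_pow (n s : ℕ) :
    Odd ((cyclotomicGenerator 2 : ZMod (2 ^ (n + 2))) ^ s).val := by
  rw [← Nat.cast_pow, ZMod.val_natCast, Nat.odd_iff,
    Nat.mod_mod_of_dvd _ (dvd_pow_self 2 (by omega)), Nat.pow_mod, Literature.NumberTheory.EllipticCurves.cyclotomicGenerator_two]
  simp

/-- **Every Riemann sum of `L₂(f, α, T)` has norm `≤ 1/2`** under the parity LAW (doubling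
`padicLRiemannSum_two` × `norm_msdMeasure_two_le_one_of_parity` at the odd classes `5ˢ`).
[cite: MazurTateTeitelbaum1986Invent, §I.13] -/
theorem norm_padicLRiemannSum_two_le_half_of_parity {α : ℚ_[2]} (hαu : ‖α‖ = 1)
    (hroot : α ^ 2 + α + 2 = 0) (h0 : ∃ K : ℤ, Odd K ∧ ratPlusSymbol f 0 = (K : ℚ) / 8)
    (hlaw : ∀ m a : ℕ, Odd a →
      ∃ k : ℤ, ratPlusSymbol f ((a : ℚ) / (2 : ℚ) ^ m) = ratPlusSymbol f 0 + (k : ℚ) / 2 ∧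
        (2 : ℤ) ∣ k - m)
    (k n : ℕ) : ‖padicLRiemannSum f α k n‖ ≤ 2⁻¹ := by
  rw [padicLRiemannSum_two]
  have hS : ‖∑ s : ZMod (2 ^ n),
      msdMeasure f α (n + 2) ((cyclotomicGenerator 2 : ZMod (2 ^ (n + 2))) ^ s.val) *
        (s.val.choose k : ℚ_[2])‖ ≤ 1 := by
    refine IsUltrametricDist.norm_sum_le_of_forall_le_of_nonneg zero_le_one fun s _ ↦ ?_
    have hc : ‖((s.val.choose k : ℕ) : ℚ_[2])‖ ≤ 1 := by
      have h := Padic.norm_int_le_one (p := 2) ((s.val.choose k : ℕ) : ℤ)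
      rwa [Int.cast_natCast] at h
    rw [norm_mul]
    calc _ ≤ 1 * 1 :=
          mul_le_mul (norm_msdMeasure_two_le_one_of_parity hαu hroot h0 hlaw n _
            (odd_val_cyclotomicGenerator_pow n s.val)) hc (norm_nonneg _) zero_le_one
      _ = 1 := mul_one _
  rw [norm_mul, norm_two_two]
  calc (2 : ℝ)⁻¹ * _ ≤ (2 : ℝ)⁻¹ * 1 := by gcongr
    _ = 2⁻¹ := mul_one _

/-- **Every coefficient of `L₂(f, α, T)` lies in `2ℤ₂`** (norm `≤ 1/2`) for a newform of odd level with
real coefficients, `a₂ = −1`, `α` the unit root, granted the distribution relation `hdist` and the parity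
LAW: the Riemann sums have norm `≤ 1/2` and converge (`tendsto_padicLRiemannSum_of_norm_le`, bound `2` from
`norm_msdMeasure_two_le_two_auto`). [cite: MazurTateTeitelbaum1986Invent, §I.10–§I.13] -/
theorem norm_padicLCoeff_two_le_half_of_parity (hf : IsNewform0 f)
    (hreal : ∀ n, (cuspCoeff f n).im = 0) (h2N : ¬ 2 ∣ N) {a₂ : ℤ} (ha₂ : cuspCoeff f 2 = a₂)
    (hneg : a₂ = -1) {α : ℚ_[2]} (hαu : ‖α‖ = 1) (hroot : α ^ 2 - a₂ * α + 2 = 0)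
    (hdist : ∀ (n : ℕ) (a : ZMod (2 ^ n)),
      ∑ b ∈ Finset.univ.filter (fun b : ZMod (2 ^ (n + 1)) ↦
        ZMod.castHom (pow_dvd_pow 2 n.le_succ) (ZMod (2 ^ n)) b = a), msdMeasure f α (n + 1) b =
        msdMeasure f α n a)
    (h0 : ∃ K : ℤ, Odd K ∧ ratPlusSymbol f 0 = (K : ℚ) / 8)
    (hlaw : ∀ m a : ℕ, Odd a →
      ∃ k : ℤ, ratPlusSymbol f ((a : ℚ) / (2 : ℚ) ^ m) = ratPlusSymbol f 0 + (k : ℚ) / 2 ∧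
        (2 : ℤ) ∣ k - m)
    (k : ℕ) : ‖padicLCoeff f α k‖ ≤ 2⁻¹ := by
  have hα : ‖α⁻¹‖ ≤ 1 := by rw [norm_inv, hαu, inv_one]
  have hroot' : α ^ 2 + α + 2 = 0 := by
    subst hneg; push_cast at hroot; linear_combination hroot
  have hμ := norm_msdMeasure_two_le_two_auto hf hreal h2N ha₂ hα hroot
  exact le_of_tendsto (tendsto_padicLRiemannSum_of_norm_le hdist ⟨2, hμ⟩ k).norm
    (Eventually.of_forall fun n ↦ norm_padicLRiemannSum_two_le_half_of_parity hαu hroot' h0 hlaw k n)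

omit [NeZero N] in
/-- **The constant term is `(1 − α⁻¹)²[0]⁺ = 2Kα⁻⁶`, of norm EXACTLY `1/2`** (`padicLRiemannSum_zero`).
[cite: MazurTateTeitelbaum1986Invent, §I.14 (14.3)] -/
theorem norm_padicLCoeff_two_zero_eq_half_of_parity {α : ℚ_[2]} (hαu : ‖α‖ = 1)
    (hroot : α ^ 2 + α + 2 = 0)
    (hdist : ∀ (n : ℕ) (a : ZMod (2 ^ n)),
      ∑ b ∈ Finset.univ.filter (fun b : ZMod (2 ^ (n + 1)) ↦
        ZMod.castHom (pow_dvd_pow 2 n.le_succ) (ZMod (2 ^ n)) b = a), msdMeasure f α (n + 1) b =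
        msdMeasure f α n a)
    (h0 : ∃ K : ℤ, Odd K ∧ ratPlusSymbol f 0 = (K : ℚ) / 8) :
    ‖padicLCoeff f α 0‖ = 2⁻¹ := by
  obtain ⟨K, hK, hK0⟩ := h0
  rw [padicLCoeff, (tendsto_const_nhds.congr fun n ↦ (padicLRiemannSum_zero hdist n).symm).limUnder_eq,
    hK0, one_sub_inv_eq_four_mul hroot]
  push_cast
  rw [show (4 * α⁻¹ ^ 3) ^ 2 * ((K : ℚ_[2]) / 8) = 2 * (K : ℚ_[2]) * (α⁻¹ ^ 3) ^ 2 by ring,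
    norm_mul, norm_mul, norm_pow, norm_pow, norm_inv, hαu, norm_two_two,
    norm_intCast_eq_one_of_odd hK]
  norm_num

/-! ### §2 `L₂(f, α, T) = 2·ι(u)`, `u ∈ Λˣ`; every integral multiple has `λ = 0` -/

/-- **`L₂(f, α, T)/2 = ι(u)` with `u` a UNIT of `Λ = ℤ₂⟦T⟧`** under the hypotheses of
`norm_padicLCoeff_two_le_half_of_parity`: the coefficients of `L₂/2` have norm `≤ 1`
(`exists_iwasawaToPowerSeries_eq_iff_norm_coeff_le_one`) and its constant term has norm `1`.
[cite: MazurTateTeitelbaum1986Invent, §I.12] [cite: Washington1997, §7.1] -/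
theorem exists_isUnit_iwasawa_of_parity (hf : IsNewform0 f)
    (hreal : ∀ n, (cuspCoeff f n).im = 0) (h2N : ¬ 2 ∣ N) {a₂ : ℤ} (ha₂ : cuspCoeff f 2 = a₂)
    (hneg : a₂ = -1) {α : ℚ_[2]} (hαu : ‖α‖ = 1) (hroot : α ^ 2 - a₂ * α + 2 = 0)
    (hdist : ∀ (n : ℕ) (a : ZMod (2 ^ n)),
      ∑ b ∈ Finset.univ.filter (fun b : ZMod (2 ^ (n + 1)) ↦
        ZMod.castHom (pow_dvd_pow 2 n.le_succ) (ZMod (2 ^ n)) b = a), msdMeasure f α (n + 1) b =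
        msdMeasure f α n a)
    (h0 : ∃ K : ℤ, Odd K ∧ ratPlusSymbol f 0 = (K : ℚ) / 8)
    (hlaw : ∀ m a : ℕ, Odd a →
      ∃ k : ℤ, ratPlusSymbol f ((a : ℚ) / (2 : ℚ) ^ m) = ratPlusSymbol f 0 + (k : ℚ) / 2 ∧
        (2 : ℤ) ∣ k - m) :
    ∃ u : IwasawaAlgebra 2, IsUnit u ∧
      iwasawaToPowerSeries 2 u = PowerSeries.C ((2 : ℚ_[2])⁻¹) * padicLFunction f α := by
  have hroot' : α ^ 2 + α + 2 = 0 := by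
    subst hneg; push_cast at hroot; linear_combination hroot
  have hcoeff : ∀ k, ‖PowerSeries.coeff k (PowerSeries.C ((2 : ℚ_[2])⁻¹) * padicLFunction f α)‖ ≤ 1 := by
    intro k
    rw [PowerSeries.coeff_C_mul, coeff_padicLFunction, norm_mul, norm_inv, norm_two_two, inv_inv]
    calc (2 : ℝ) * ‖padicLCoeff f α k‖ ≤ 2 * 2⁻¹ := by
          gcongr
          exact norm_padicLCoeff_two_le_half_of_parity hf hreal h2N ha₂ hneg hαu hroot hdist h0 hlaw k
      _ = 1 := by norm_num
  obtain ⟨u, hu⟩ := (exists_iwasawaToPowerSeries_eq_iff_norm_coeff_le_one _).mpr hcoeff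
  refine ⟨u, ?_, hu⟩
  -- the constant term of `u` is a `2`-adic unit
  apply PowerSeries.isUnit_iff_constantCoeff.mpr
  rw [PadicInt.isUnit_iff, ← PowerSeries.coeff_zero_eq_constantCoeff_apply, PadicInt.norm_def]
  have h := congrArg (PowerSeries.coeff 0) hu
  rw [PowerSeries.coeff_map, PowerSeries.coeff_C_mul, coeff_padicLFunction] at h
  change ((PowerSeries.coeff 0 u : ℤ_[2]) : ℚ_[2]) = _ at h
  rw [h, norm_mul, norm_inv, norm_two_two, inv_inv,
    norm_padicLCoeff_two_zero_eq_half_of_parity hαu hroot' hdist h0]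
  norm_num

/-- **Every nonzero integral multiple of `L` has `λ = 0` once `L/2 = ι(u)` with `u ∈ Λˣ`** (pure algebra of
`Λ = ℤ₂⟦T⟧`): `ι L₀ = c·L = C(2c)·ι(u)` forces `L₀·u⁻¹ = C d'` with `d' ∈ ℤ₂ ∖ {0}`, `d' = v·2^a` (`v ∈ ℤ₂ˣ`), so
`L₀ = 2^a · (C v · u)` with `C v · u` a unit: `μ(L₀) = a` and `λ(L₀) = ord_T((C v·u) mod 2) = 0`
(`MuLambda.mu_eq_and_pfree_eq`, `PowerSeries.order_zero_of_unit`). [cite: Washington1997, §7.1] -/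
theorem lam_eq_zero_of_isUnit_multiple {u : IwasawaAlgebra 2} (hu : IsUnit u) {L : PowerSeries ℚ_[2]}
    (hι : iwasawaToPowerSeries 2 u = PowerSeries.C ((2 : ℚ_[2])⁻¹) * L)
    {c : ℚ_[2]} {L₀ : IwasawaAlgebra 2} (hL₀ : L₀ ≠ 0)
    (hmult : iwasawaToPowerSeries 2 L₀ = PowerSeries.C c * L) :
    MuLambda.lam L₀ = 0 := by
  obtain ⟨w, rfl⟩ := hu
  -- `L = 2·ι(w)` and `ι(L₀ · w⁻¹) = C (2c)`
  have hL : L = PowerSeries.C (2 : ℚ_[2]) * iwasawaToPowerSeries 2 (w : IwasawaAlgebra 2) := by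
    rw [hι, ← mul_assoc, ← map_mul, mul_inv_cancel₀ two_ne_zero, map_one, one_mul]
  have hprod : iwasawaToPowerSeries 2 (L₀ * ↑w⁻¹) = PowerSeries.C (c * 2) := by
    rw [map_mul, hmult, hL, ← mul_assoc, ← map_mul, mul_assoc, ← map_mul, Units.mul_inv, map_one,
      mul_one]
  -- hence `L₀ · w⁻¹` is the constant `d' := (L₀ · w⁻¹)₀ ∈ ℤ₂`
  set d' : ℤ_[2] := PowerSeries.coeff 0 (L₀ * ↑w⁻¹) with hd'def
  have hd' : algebraMap ℤ_[2] ℚ_[2] d' = c * 2 := by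
    have h := congrArg (PowerSeries.coeff 0) hprod
    rwa [PowerSeries.coeff_map, PowerSeries.coeff_zero_C] at h
  have h1 : L₀ * ↑w⁻¹ = PowerSeries.C d' := by
    apply iwasawaToPowerSeries_injective 2
    rw [hprod, ← hd']
    simp [iwasawaToPowerSeries]
  have hfac : L₀ = PowerSeries.C d' * ↑w := by
    rw [← h1, Units.inv_mul_cancel_right]
  have hd'0 : d' ≠ 0 := by
    rintro h; apply hL₀; rw [hfac, h, map_zero, zero_mul]
  -- `d' = v · 2^a`, `v` a unit
  have hsp := PadicInt.unitCoeff_spec hd'0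
  have hdec : L₀ = PowerSeries.C (((2 : ℕ) : ℤ_[2]) ^ d'.valuation) *
      (PowerSeries.C ((PadicInt.unitCoeff hd'0 : ℤ_[2])) * ↑w) := by
    rw [hfac]
    conv_lhs => rw [hsp]
    rw [map_mul, ← mul_assoc, mul_comm (PowerSeries.C _) (PowerSeries.C _)]
  have hunit : IsUnit (PowerSeries.C ((PadicInt.unitCoeff hd'0 : ℤ_[2])) * (w : IwasawaAlgebra 2)) :=
    ((PadicInt.unitCoeff hd'0).isUnit.map PowerSeries.C).mul w.isUnit
  have hred : MuLambda.red (PowerSeries.C ((PadicInt.unitCoeff hd'0 : ℤ_[2])) * (w : IwasawaAlgebra 2)) ≠ 0 :=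
    (hunit.map (PowerSeries.map (IsLocalRing.residue ℤ_[2]))).ne_zero
  obtain ⟨-, hpf⟩ := MuLambda.mu_eq_and_pfree_eq hred hdec
  rw [MuLambda.lam, hpf, PowerSeries.order_zero_of_unit (hunit.map _)]
  rfl

end Generic

/-! ### §3 The reference curve `refFifteen = [1,1,1,0,0]` (Cremona 15A8) -/

section RefFifteen

open WeierstrassCurve

/-- **`a₂([1,1,1,0,0]) = −1`** (`#Ẽ(𝔽₂) = 4`; any global-minimality witness). [cite: CremonaAlgorithms1997, Table 1 (15A)] -/
theorem refFifteen_frobeniusTrace_two (hmin : (⟨1, 1, 1, 0, 0⟩ : WeierstrassCurve ℚ).IsGloballyMinimal) :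
    @frobeniusTrace (⟨1, 1, 1, 0, 0⟩ : WeierstrassCurve ℚ) hmin 2 = -1 := by
  rw [frobeniusTrace, reductionPointCount, refFifteen_integralModelInt, refFifteenInt_map_zmod_two,
    natCard_point_refFifteen_F2]
  norm_num

/-- **X₂(d), analytic core, for `refFifteen`: `L₂(f₁₅, α)/2 = ι(u)`, `u ∈ Λˣ`**, for any `f` with
`IsNewformOf [1,1,1,0,0] f`, GIVEN the level-15 symbol facts `[0]⁺_f = K/8` (`K` odd) and the parity LAW
`[a/2^m]⁺_f − [0]⁺_f = k/2`, `k ≡ m (mod 2)` (`a` odd) — a finite modular-symbol computation, displayed as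
hypotheses. Ordinarity at `2` (p510347), `a₂ = −1`, the unit root and the distribution relation are the tree's.
[cite: MazurTateTeitelbaum1986Invent, §I.10–§I.13] [cite: CremonaAlgorithms1997, §2.8 and Table 4 (N = 15)] -/
theorem refFifteen_exists_isUnit_iwasawa_of_parity
    (hmin : (⟨1, 1, 1, 0, 0⟩ : WeierstrassCurve ℚ).IsGloballyMinimal)
    {N : ℕ} [NeZero N] {f : CuspForm (Gamma0 N) 2} (hf : IsNewformOf (⟨1, 1, 1, 0, 0⟩ : WeierstrassCurve ℚ) f)
    (h0 : ∃ K : ℤ, Odd K ∧ ratPlusSymbol f 0 = (K : ℚ) / 8)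
    (hlaw : ∀ m a : ℕ, Odd a →
      ∃ k : ℤ, ratPlusSymbol f ((a : ℚ) / (2 : ℚ) ^ m) = ratPlusSymbol f 0 + (k : ℚ) / 2 ∧
        (2 : ℤ) ∣ k - m) :
    ∃ u : IwasawaAlgebra 2, IsUnit u ∧
      iwasawaToPowerSeries 2 u = PowerSeries.C ((2 : ℚ_[2])⁻¹) *
        padicLFunction f (@unitRoot (⟨1, 1, 1, 0, 0⟩ : WeierstrassCurve ℚ) hmin 2 _ : ℚ_[2]) := by
  haveI : (⟨1, 1, 1, 0, 0⟩ : WeierstrassCurve ℚ).IsElliptic := refFifteen_isElliptic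
  have hord := refFifteen_isOrdinaryAt_two hmin
  obtain ⟨hαeq, hαu, -⟩ := unitRoot_coe_spec (W := (⟨1, 1, 1, 0, 0⟩ : WeierstrassCurve ℚ)) hord
  have ha₂ : cuspCoeff f 2 = ((-1 : ℤ) : ℂ) := by
    rw [cuspCoeff_eq_frobeniusTrace_of_isNewformOf_holds hf hord.1, refFifteen_frobeniusTrace_two hmin]
  rw [refFifteen_frobeniusTrace_two hmin] at hαeq
  exact exists_isUnit_iwasawa_of_parity hf.1 (cuspCoeff_im_eq_zero_of_coeffField_eq_bot hf.coeffField_eq_bot)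
    (not_dvd_level_of_isNewformOf hf hord.1) ha₂ rfl hαu hαeq
    (msdMeasure_distribution_of_isNewformOf hord hf) h0 hlaw

/-- **X₂(d) for `refFifteen`, `λ`-form: EVERY nonzero integral multiple `L₀` of `L₂(f₁₅, α)` (`ι L₀ = c·L₂`,
`c ∈ ℚ₂`) has `λ(L₀) = 0`**, given the level-15 symbol facts. [cite: MazurTateTeitelbaum1986Invent, §I.12–§I.13] -/
theorem refFifteen_lam_eq_zero_of_parity
    (hmin : (⟨1, 1, 1, 0, 0⟩ : WeierstrassCurve ℚ).IsGloballyMinimal)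
    {N : ℕ} [NeZero N] {f : CuspForm (Gamma0 N) 2} (hf : IsNewformOf (⟨1, 1, 1, 0, 0⟩ : WeierstrassCurve ℚ) f)
    (h0 : ∃ K : ℤ, Odd K ∧ ratPlusSymbol f 0 = (K : ℚ) / 8)
    (hlaw : ∀ m a : ℕ, Odd a →
      ∃ k : ℤ, ratPlusSymbol f ((a : ℚ) / (2 : ℚ) ^ m) = ratPlusSymbol f 0 + (k : ℚ) / 2 ∧
        (2 : ℤ) ∣ k - m)
    {c : ℚ_[2]} {L₀ : IwasawaAlgebra 2} (hL₀ : L₀ ≠ 0)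
    (hmult : iwasawaToPowerSeries 2 L₀ = PowerSeries.C c *
      padicLFunction f (@unitRoot (⟨1, 1, 1, 0, 0⟩ : WeierstrassCurve ℚ) hmin 2 _ : ℚ_[2])) :
    MuLambda.lam L₀ = 0 := by
  obtain ⟨u, hu, hι⟩ := refFifteen_exists_isUnit_iwasawa_of_parity hmin hf h0 hlaw
  exact lam_eq_zero_of_isUnit_multiple hu hι hL₀ hmult

/-- **X₂(d) for `refFifteen` in the shape of the cell's `LambdaHalfAtTwo` / door Props**: some nonzero integral
RATIONAL multiple `L₀` of `L₂(f₁₅, α)` has `λ(L₀) = 0` AND `μ(L₀) = 0` (namely `c = 1/2`, `L₀ = u`), given the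
level-15 symbol facts. [cite: MazurTateTeitelbaum1986Invent, §I.12–§I.13] -/
theorem refFifteen_exists_lam_eq_zero_of_parity
    (hmin : (⟨1, 1, 1, 0, 0⟩ : WeierstrassCurve ℚ).IsGloballyMinimal)
    {N : ℕ} [NeZero N] {f : CuspForm (Gamma0 N) 2} (hf : IsNewformOf (⟨1, 1, 1, 0, 0⟩ : WeierstrassCurve ℚ) f)
    (h0 : ∃ K : ℤ, Odd K ∧ ratPlusSymbol f 0 = (K : ℚ) / 8)
    (hlaw : ∀ m a : ℕ, Odd a →
      ∃ k : ℤ, ratPlusSymbol f ((a : ℚ) / (2 : ℚ) ^ m) = ratPlusSymbol f 0 + (k : ℚ) / 2 ∧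
        (2 : ℤ) ∣ k - m) :
    ∃ (c : ℚ) (L₀ : IwasawaAlgebra 2), L₀ ≠ 0 ∧
      iwasawaToPowerSeries 2 L₀ = PowerSeries.C (c : ℚ_[2]) *
        padicLFunction f (@unitRoot (⟨1, 1, 1, 0, 0⟩ : WeierstrassCurve ℚ) hmin 2 _ : ℚ_[2]) ∧
      MuLambda.lam L₀ = 0 ∧ MuLambda.mu L₀ = 0 := by
  obtain ⟨u, hu, hι⟩ := refFifteen_exists_isUnit_iwasawa_of_parity hmin hf h0 hlaw
  obtain ⟨hne, hmu, hlam⟩ := (MuLambda.isUnit_iff_mu_eq_zero_and_lam_eq_zero u).mp hu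
  refine ⟨1 / 2, u, hne, ?_, hlam, hmu⟩
  rw [hι]
  congr 2
  push_cast
  ring

end RefFifteen

end Summit.BirchSwinnertonDyer.Rank2.SymbolParityAtTwo

end
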